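import Summits.NavierStokesRegularity.NavierStokesRegularity.Theorems.ScalingDefectPeepholeDoorSlicePressure
import Literature.Analysis.FluidPDE.CKNLocalRegularityRRSStep3

/-!
# QuietScarPocketDoorZoomPressureD — door S31 «QuietScarPocketDoor» (nsreg-p1 g25 ROUND-29 v2.1, texts `r29/Sketch31.lean`
# 363b5766493b6c28; Defs p622283), K-piece PK1 `scarPocketZoom_holds`, file F1b: THE SCALED PRESSURE QUANTITY OF THE
# PINEAU–VICOL CLASS ON ALL SMALL APEX SUB-CYLINDERS

* `exists_pv_cknD_le` (F1b of the LEAD skeleton `HOME/ns-s30-p1/PK1-Skeleton.lean`): for every `C_u` there is `K(C_u)` and, for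
  every shell level `C_p`, a radius `μ(C_u,C_p) ≤ 1/32` such that `D(r;z) = r⁻² ∫∫_{Q(z,r)} |p|^{3/2} ≤ K` for EVERY parabolic
  cylinder `Q(z,r) ⊆ Q(0,μ)` and every classical solution of the Pineau–Vicol class on the unit apex cylinder.

Proof (pure bookkeeping on ns-s29-p2's `L²` slice pressure bound, door S30): Hölder `3/2 → 2` on the ball `B(z.2,r)`,
`∫_{B_{1/32}} p(t)² ≤ C₁ ∫_{B_{3/4}} |u(t)|⁴ + C₂(C_p)` (`exists_forall_lintegral_ball_pressure_sq_le`), the sharp Type-I level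
`∫_{B_{3/4}} |u(t)|⁴ ≤ 4|B₁|C_u⁴/√(−t)` (`lintegral_ball_typeI_four_le`), `(−t)^{−3/8} ≤ (z.1−t)^{−3/8}` and
`∫_{z.1−r²}^{z.1} (z.1−t)^{−3/8} dt = (8/5) r^{5/4}`: `D(r;z) ≤ (8/5)(4C₁|B₁|C_u⁴)^{3/4}|B₁|^{1/4} + |B₁|^{1/4}C₂^{3/4} r^{3/4}`, and the
last term is `≤ 1` once `r ≤ μ`.  The `C_u`-part is exactly scale-invariant; the shell level `C_p` is washed out by smallness of
the cylinder — this is the «harmonic pressure washout» of the S29/S30 transfers in its `L^{3/2}` form.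

Door S31 is a regularity CRITERION about a HYPOTHETICAL one-point Type-I blow-up; item 0056 `NoTypeII` and NS regularity are
NOT proved and stay OPEN.
-/

noncomputable section

set_option linter.dupNamespace false

namespace Summit.NavierStokesRegularity.NavierStokesRegularity.Theorems.QuietScarPocketDoor

open MeasureTheory Set Function Filter Topology TopologicalSpace Metric
open scoped NNReal ENNReal Topology
open Literature.Analysis Literature.Analysis.FluidPDE
open Summit.NavierStokesRegularity.NavierStokesRegularity.Theorems.ScalingDefectPeepholeDoor
  (exists_forall_lintegral_ball_pressure_sq_le lintegral_ball_typeI_four_le)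

/-- time factors on a cylinder with top time `z₁`: `∫_{z₁−r²}^{z₁} (z₁ − t)^{e} dt = (r²)^{e+1}/(e+1)` for `−1 < e`. -/
theorem lintegral_Ioo_rpow_sub_eq (z₁ : ℝ) {r e : ℝ} (hr : 0 < r) (he : -1 < e) :
    ∫⁻ t in Ioo (z₁ - r ^ 2) z₁, ENNReal.ofReal ((z₁ - t) ^ e) =
      ENNReal.ofReal ((r ^ 2) ^ (e + 1) / (e + 1)) := by
  have hr2 : 0 < r ^ 2 := by positivity
  have hii : IntervalIntegrable (fun σ : ℝ => σ ^ e) volume 0 (r ^ 2) :=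
    intervalIntegral.intervalIntegrable_rpow' he
  have hii' : IntervalIntegrable (fun t : ℝ => (z₁ - t) ^ e) volume (z₁ - r ^ 2) z₁ := by
    have h := (hii.comp_sub_left z₁).symm
    simpa only [sub_zero] using h
  have hint : IntegrableOn (fun t : ℝ => (z₁ - t) ^ e) (Ioo (z₁ - r ^ 2) z₁) volume :=
    (intervalIntegrable_iff_integrableOn_Ioo_of_le (by linarith)).1 hii'
  have hnn : 0 ≤ᵐ[volume.restrict (Ioo (z₁ - r ^ 2) z₁)] fun t : ℝ => (z₁ - t) ^ e :=
    (ae_restrict_iff' measurableSet_Ioo).2 (ae_of_all _ fun t ht => Real.rpow_nonneg (by linarith [ht.2]) _)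
  rw [← ofReal_integral_eq_lintegral_ofReal hint hnn]
  congr 1
  rw [← integral_Ioc_eq_integral_Ioo, ← intervalIntegral.integral_of_le (by linarith),
    intervalIntegral.integral_comp_sub_left (fun σ : ℝ => σ ^ e) z₁]
  simp only [sub_self, sub_sub_cancel]
  rw [integral_rpow (Or.inl he), Real.zero_rpow (by linarith), sub_zero]

/-- a parabolic sub-cylinder `Q(z,r) ⊆ Q(0,ρ)`: time interval in `(−ρ²,0)`, ball in `B_ρ`, and `r ≤ ρ`. -/
theorem apex_subcylinder {r ρ : ℝ} (hr : 0 < r) (hρ : 0 < ρ) {z : ℝ × EuclideanSpace ℝ (Fin 3)}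
    (hQ : parabolicCylinder r z ⊆ parabolicCylinder ρ (0 : ℝ × EuclideanSpace ℝ (Fin 3))) :
    -ρ ^ 2 ≤ z.1 - r ^ 2 ∧ z.1 ≤ 0 ∧ ball z.2 r ⊆ ball (0 : EuclideanSpace ℝ (Fin 3)) ρ ∧ r ≤ ρ := by
  have hne1 : (Ioo (z.1 - r ^ 2) z.1).Nonempty := nonempty_Ioo.2 (by nlinarith)
  have hne2 : (ball z.2 r).Nonempty := nonempty_ball.2 hr
  have h := (prod_subset_prod_iff.1 (show Ioo (z.1 - r ^ 2) z.1 ×ˢ ball z.2 r ⊆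
    Ioo ((0 : ℝ × EuclideanSpace ℝ (Fin 3)).1 - ρ ^ 2) (0 : ℝ × EuclideanSpace ℝ (Fin 3)).1 ×ˢ
      ball (0 : ℝ × EuclideanSpace ℝ (Fin 3)).2 ρ from hQ))
  rcases h with ⟨h1, h2⟩ | h | h
  · have h1' := (Ioo_subset_Ioo_iff (by nlinarith : z.1 - r ^ 2 < z.1)).1 h1
    simp only [Prod.fst_zero, zero_sub] at h1'
    refine ⟨h1'.1, h1'.2, by simpa using h2, ?_⟩
    nlinarith [h1'.1, h1'.2]
  · exact absurd h hne1.ne_empty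
  · exact absurd h hne2.ne_empty

/-- Hölder `3/2 → 2` on a ball of `ℝ³`: `∫_B |π|^{3/2} ≤ (∫_B π²)^{3/4} · (|B₁| r³)^{1/4}`. -/
theorem lintegral_ball_rpow_threeHalves_le_of_sq {π : EuclideanSpace ℝ (Fin 3) → ℝ} {c : EuclideanSpace ℝ (Fin 3)}
    {r : ℝ} (hr : 0 < r) (hπ : AEMeasurable π (volume.restrict (ball c r))) :
    ∫⁻ x in ball c r, ‖π x‖ₑ ^ (3 / 2 : ℝ) ≤
      (∫⁻ x in ball c r, ‖π x‖ₑ ^ (2 : ℝ)) ^ (3 / 4 : ℝ) *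
        ENNReal.ofReal (volume.real (ball (0 : EuclideanSpace ℝ (Fin 3)) 1) * r ^ 3) ^ (1 / 4 : ℝ) := by
  have hpq : (4 / 3 : ℝ).HolderConjugate 4 := Real.holderConjugate_iff.2 ⟨by norm_num, by norm_num⟩
  have hf : AEMeasurable (fun x => ‖π x‖ₑ ^ (3 / 2 : ℝ)) (volume.restrict (ball c r)) := hπ.enorm.pow_const _
  have hg : AEMeasurable (fun _ : EuclideanSpace ℝ (Fin 3) => (1 : ℝ≥0∞)) (volume.restrict (ball c r)) :=
    aemeasurable_const
  have h := ENNReal.lintegral_mul_le_Lp_mul_Lq (volume.restrict (ball c r)) hpq hf hg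
  have hvol : volume (ball c r) = ENNReal.ofReal (volume.real (ball (0 : EuclideanSpace ℝ (Fin 3)) 1) * r ^ 3) := by
    rw [Measure.addHaar_ball volume c hr.le, finrank_euclideanSpace_fin, mul_comm,
      ENNReal.ofReal_mul measureReal_nonneg, ofReal_measureReal measure_ball_lt_top.ne]
  have hpow : ∀ x : EuclideanSpace ℝ (Fin 3), (‖π x‖ₑ ^ (3 / 2 : ℝ)) ^ (4 / 3 : ℝ) = ‖π x‖ₑ ^ (2 : ℝ) := by
    intro x
    rw [← ENNReal.rpow_mul]
    norm_num
  simp only [Pi.mul_apply, mul_one, hpow, ENNReal.one_rpow, lintegral_const, Measure.restrict_apply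
    MeasurableSet.univ, univ_inter, one_mul] at h
  rw [hvol, show (1 : ℝ) / (4 / 3) = 3 / 4 by norm_num] at h
  exact h

/-- **F1b — the scaled pressure quantity of the Pineau–Vicol class is bounded on every small apex sub-cylinder, uniformly in
the shell level**: for every `C_u` there is `K` and for every `C_p` a radius `0 < μ ≤ 1/32` with `D(r;z) ≤ K` for all
`Q(z,r) ⊆ Q(0,μ)`. -/
theorem exists_pv_cknD_le (Cu : ℝ) : ∃ K : ℝ≥0, ∀ Cp : ℝ, ∃ μ : ℝ, 0 < μ ∧ μ ≤ 1 / 32 ∧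
    ∀ (u : ℝ → EuclideanSpace ℝ (Fin 3) → EuclideanSpace ℝ (Fin 3)) (p : ℝ → EuclideanSpace ℝ (Fin 3) → ℝ),
    IsClassicalNSSolutionOnRegion (Ico (-1 : ℝ) 0 ×ˢ ball (0 : EuclideanSpace ℝ (Fin 3)) 1) 1 0 u p →
    (∀ t ∈ Ico (-1 : ℝ) 0, ∀ x ∈ ball (0 : EuclideanSpace ℝ (Fin 3)) 1, ‖u t x‖ ≤ Cu / (Real.sqrt (-t) + ‖x‖)) →
    (∀ t ∈ Ico (-1 : ℝ) 0, ∀ x : EuclideanSpace ℝ (Fin 3), 1 / 2 < ‖x‖ → ‖x‖ < 3 / 4 → |p t x| ≤ Cp) →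
    ∀ (r : ℝ) (z : ℝ × EuclideanSpace ℝ (Fin 3)), 0 < r →
      parabolicCylinder r z ⊆ parabolicCylinder μ (0 : ℝ × EuclideanSpace ℝ (Fin 3)) →
      cknD r z p ≤ K := by
  obtain ⟨C₁, hC₁⟩ := exists_forall_lintegral_ball_pressure_sq_le
  set V : ℝ := volume.real (ball (0 : EuclideanSpace ℝ (Fin 3)) 1) with hV
  have hV0 : 0 ≤ V := measureReal_nonneg
  -- the class constants
  set a : ℝ := (C₁ : ℝ) * (4 * V * Cu ^ 4) with ha_def
  have ha0 : 0 ≤ a := by positivity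
  set A : ℝ := a ^ (3 / 4 : ℝ) with hA_def
  have hA0 : 0 ≤ A := Real.rpow_nonneg ha0 _
  set W : ℝ := V ^ (1 / 4 : ℝ) with hW_def
  have hW0 : 0 ≤ W := Real.rpow_nonneg hV0 _
  refine ⟨(8 / 5 * A * W + 1).toNNReal, fun Cp => ?_⟩
  obtain ⟨C₂, hC₂⟩ := hC₁ Cp
  set B : ℝ := W * (C₂ : ℝ) ^ (3 / 4 : ℝ) with hB_def
  have hB0 : 0 ≤ B := mul_nonneg hW0 (Real.rpow_nonneg C₂.coe_nonneg _)
  set μ : ℝ := min (1 / 32) (((1 + B) ^ 2)⁻¹) with hμ_def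
  have h1B : 1 ≤ 1 + B := by linarith
  have hμpos : 0 < μ := lt_min (by norm_num) (by positivity)
  have hμ32 : μ ≤ 1 / 32 := min_le_left _ _
  refine ⟨μ, hμpos, hμ32, fun u p hreg hI hP r z hr hQ => ?_⟩
  obtain ⟨hz1, hz0, hball, hrμ⟩ := apex_subcylinder hr hμpos hQ
  have hr1 : r ≤ 1 := hrμ.trans (hμ32.trans (by norm_num))
  have hμ1 : μ ^ 2 ≤ 1 := by nlinarith [hμ32, hμpos]
  have hball32 : ball z.2 r ⊆ ball (0 : EuclideanSpace ℝ (Fin 3)) (1 / 32) := hball.trans (ball_subset_ball hμ32)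
  have hball1 : ball z.2 r ⊆ ball (0 : EuclideanSpace ℝ (Fin 3)) 1 := hball.trans (ball_subset_ball (by linarith))
  -- ## the slice bound
  have hslice : ∀ t ∈ Ioo (z.1 - r ^ 2) z.1,
      ∫⁻ x in ball z.2 r, ‖p t x‖ₑ ^ (3 / 2 : ℝ) ≤
        ENNReal.ofReal ((A * (z.1 - t) ^ (-(3 / 8 : ℝ)) + (C₂ : ℝ) ^ (3 / 4 : ℝ)) * (W * r ^ (3 / 4 : ℝ))) := by
    intro t ht
    have ht0 : t ∈ Ioo (-1 : ℝ) 0 := ⟨by linarith [ht.1], by linarith [ht.2]⟩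
    have htI : t ∈ Ico (-1 : ℝ) 0 := Ioo_subset_Ico_self ht0
    have hnt : 0 < -t := by linarith [ht0.2]
    have hzt : 0 < z.1 - t := by linarith [ht.2]
    -- measurability of the slice on the ball
    have hsec : spaceSection (Ico (-1 : ℝ) 0 ×ˢ ball (0 : EuclideanSpace ℝ (Fin 3)) 1) t = ball 0 1 :=
      spaceSection_prod htI _
    have hpc := hreg.contDiffOn_pressure t
    rw [hsec] at hpc
    have hπ : AEMeasurable (p t) (volume.restrict (ball z.2 r)) :=
      (hpc.continuousOn.mono hball1).aemeasurable measurableSet_ball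
    -- `L²` on the ball from the `L²` slice bound on `B_{1/32}` and the Type-I `L⁴` level
    have h2 : ∫⁻ x in ball z.2 r, ‖p t x‖ₑ ^ (2 : ℝ) ≤ ENNReal.ofReal (a * (-t) ^ (-(1 / 2 : ℝ)) + (C₂ : ℝ)) := by
      have hX := lintegral_ball_typeI_four_le hI ht0
      calc ∫⁻ x in ball z.2 r, ‖p t x‖ₑ ^ (2 : ℝ)
          ≤ ∫⁻ x in ball (0 : EuclideanSpace ℝ (Fin 3)) (1 / 32), ‖p t x‖ₑ ^ (2 : ℝ) := lintegral_mono_set hball32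
        _ ≤ C₁ * (∫⁻ x in ball (0 : EuclideanSpace ℝ (Fin 3)) (3 / 4), ‖u t x‖ₑ ^ (4 : ℕ)) + C₂ := hC₂ u p hreg hP t ht0
        _ ≤ C₁ * ENNReal.ofReal (4 * V * Cu ^ 4 / Real.sqrt (-t)) + C₂ := by gcongr
        _ = ENNReal.ofReal (a * (-t) ^ (-(1 / 2 : ℝ)) + (C₂ : ℝ)) := by
            have hx : 4 * V * Cu ^ 4 / Real.sqrt (-t) = 4 * V * Cu ^ 4 * (-t) ^ (-(1 / 2 : ℝ)) := by
              rw [Real.sqrt_eq_rpow, Real.rpow_neg hnt.le, div_eq_mul_inv]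
            rw [hx, ENNReal.ofReal_add (by positivity) C₂.coe_nonneg, ENNReal.ofReal_coe_nnreal, ha_def,
              show (C₁ : ℝ) * (4 * V * Cu ^ 4) * (-t) ^ (-(1 / 2 : ℝ)) =
                (C₁ : ℝ) * (4 * V * Cu ^ 4 * (-t) ^ (-(1 / 2 : ℝ))) by ring,
              ENNReal.ofReal_mul C₁.coe_nonneg, ENNReal.ofReal_coe_nnreal]
    -- Hölder and the real majorant
    have hH := lintegral_ball_rpow_threeHalves_le_of_sq hr hπ
    have hΦ0 : 0 ≤ a * (-t) ^ (-(1 / 2 : ℝ)) + (C₂ : ℝ) := by positivity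
    have hreal : (a * (-t) ^ (-(1 / 2 : ℝ)) + (C₂ : ℝ)) ^ (3 / 4 : ℝ) * (V * r ^ 3) ^ (1 / 4 : ℝ) ≤
        (A * (z.1 - t) ^ (-(3 / 8 : ℝ)) + (C₂ : ℝ) ^ (3 / 4 : ℝ)) * (W * r ^ (3 / 4 : ℝ)) := by
      have hsplit : (a * (-t) ^ (-(1 / 2 : ℝ)) + (C₂ : ℝ)) ^ (3 / 4 : ℝ) ≤
          (a * (-t) ^ (-(1 / 2 : ℝ))) ^ (3 / 4 : ℝ) + (C₂ : ℝ) ^ (3 / 4 : ℝ) :=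
        Real.rpow_add_le_add_rpow (mul_nonneg ha0 (Real.rpow_nonneg hnt.le _)) C₂.coe_nonneg
          (by norm_num : (0 : ℝ) ≤ 3 / 4) (by norm_num : (3 / 4 : ℝ) ≤ 1)
      have hfirst : (a * (-t) ^ (-(1 / 2 : ℝ))) ^ (3 / 4 : ℝ) ≤ A * (z.1 - t) ^ (-(3 / 8 : ℝ)) := by
        rw [Real.mul_rpow ha0 (Real.rpow_nonneg hnt.le _), ← Real.rpow_mul hnt.le,
          show (-(1 / 2 : ℝ)) * (3 / 4) = -(3 / 8 : ℝ) by norm_num]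
        exact mul_le_mul_of_nonneg_left (Real.rpow_le_rpow_of_nonpos hzt (by linarith) (by norm_num)) hA0
      have hvol : (V * r ^ 3) ^ (1 / 4 : ℝ) = W * r ^ (3 / 4 : ℝ) := by
        rw [Real.mul_rpow hV0 (by positivity), hW_def, show r ^ 3 = r ^ (3 : ℝ) by norm_cast,
          ← Real.rpow_mul hr.le]
        norm_num
      rw [hvol]
      exact mul_le_mul_of_nonneg_right (hsplit.trans (by linarith)) (by positivity)
    calc ∫⁻ x in ball z.2 r, ‖p t x‖ₑ ^ (3 / 2 : ℝ)
        ≤ (∫⁻ x in ball z.2 r, ‖p t x‖ₑ ^ (2 : ℝ)) ^ (3 / 4 : ℝ) * ENNReal.ofReal (V * r ^ 3) ^ (1 / 4 : ℝ) := hH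
      _ ≤ ENNReal.ofReal (a * (-t) ^ (-(1 / 2 : ℝ)) + (C₂ : ℝ)) ^ (3 / 4 : ℝ) *
            ENNReal.ofReal (V * r ^ 3) ^ (1 / 4 : ℝ) := by gcongr
      _ = ENNReal.ofReal ((a * (-t) ^ (-(1 / 2 : ℝ)) + (C₂ : ℝ)) ^ (3 / 4 : ℝ) * (V * r ^ 3) ^ (1 / 4 : ℝ)) := by
            rw [ENNReal.ofReal_rpow_of_nonneg hΦ0 (by norm_num),
              ENNReal.ofReal_rpow_of_nonneg (by positivity) (by norm_num), ← ENNReal.ofReal_mul (Real.rpow_nonneg hΦ0 _)]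
      _ ≤ _ := ENNReal.ofReal_le_ofReal hreal
  -- ## integrate in time
  have hmeas : AEMeasurable (fun w : ℝ × EuclideanSpace ℝ (Fin 3) => ‖p w.1 w.2‖ₑ ^ (3 / 2 : ℝ))
      (volume.restrict (parabolicCylinder r z)) := by
    have hsubO : parabolicCylinder r z ⊆ Ico (-1 : ℝ) 0 ×ˢ ball (0 : EuclideanSpace ℝ (Fin 3)) 1 := by
      intro w hw
      obtain ⟨hwt, hwx⟩ := mem_prod.1 hw
      exact mk_mem_prod ⟨by linarith [hwt.1], by linarith [hwt.2]⟩ (hball1 hwx)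
    have hc : ContinuousOn (fun w : ℝ × EuclideanSpace ℝ (Fin 3) => p w.1 w.2) (parabolicCylinder r z) :=
      hreg.smooth_pressure.continuousOn.mono hsubO
    exact ((hc.aemeasurable (measurableSet_Ioo.prod measurableSet_ball)).enorm.pow_const _)
  have hae : ∀ᵐ t ∂(volume.restrict (Ioo (z.1 - r ^ 2) z.1)),
      ∫⁻ x in ball z.2 r, (fun w : ℝ × EuclideanSpace ℝ (Fin 3) => ‖p w.1 w.2‖ₑ ^ (3 / 2 : ℝ)) (t, x) ≤
        ENNReal.ofReal ((A * (z.1 - t) ^ (-(3 / 8 : ℝ)) + (C₂ : ℝ) ^ (3 / 4 : ℝ)) * (W * r ^ (3 / 4 : ℝ))) :=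
    (ae_restrict_iff' measurableSet_Ioo).2 (ae_of_all _ fun t ht => hslice t ht)
  have hT := RRS2016.lintegral_parabolicCylinder_le_of_ae_slice hmeas hae
  -- compute the time integral of the majorant
  have hmT : Measurable fun t : ℝ => ENNReal.ofReal ((z.1 - t) ^ (-(3 / 8 : ℝ))) :=
    ((measurable_const.sub measurable_id).pow_const _).ennreal_ofReal
  have htime : ∫⁻ t in Ioo (z.1 - r ^ 2) z.1,
      ENNReal.ofReal ((A * (z.1 - t) ^ (-(3 / 8 : ℝ)) + (C₂ : ℝ) ^ (3 / 4 : ℝ)) * (W * r ^ (3 / 4 : ℝ))) =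
      ENNReal.ofReal (W * r ^ (3 / 4 : ℝ)) * (ENNReal.ofReal A * ENNReal.ofReal (8 / 5 * r ^ (5 / 4 : ℝ)) +
        ENNReal.ofReal ((C₂ : ℝ) ^ (3 / 4 : ℝ)) * ENNReal.ofReal (r ^ 2)) := by
    have hsplit : ∀ t ∈ Ioo (z.1 - r ^ 2) z.1,
        ENNReal.ofReal ((A * (z.1 - t) ^ (-(3 / 8 : ℝ)) + (C₂ : ℝ) ^ (3 / 4 : ℝ)) * (W * r ^ (3 / 4 : ℝ))) =
          ENNReal.ofReal (W * r ^ (3 / 4 : ℝ)) * (ENNReal.ofReal A * ENNReal.ofReal ((z.1 - t) ^ (-(3 / 8 : ℝ))) +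
            ENNReal.ofReal ((C₂ : ℝ) ^ (3 / 4 : ℝ))) := by
      intro t ht
      have hzt : 0 ≤ (z.1 - t) ^ (-(3 / 8 : ℝ)) := Real.rpow_nonneg (by linarith [ht.2]) _
      rw [mul_comm, ENNReal.ofReal_mul (by positivity), ENNReal.ofReal_add (mul_nonneg hA0 hzt)
        (Real.rpow_nonneg C₂.coe_nonneg _), ENNReal.ofReal_mul hA0]
    have e1 : (r ^ 2) ^ (-(3 / 8 : ℝ) + 1) / (-(3 / 8 : ℝ) + 1) = 8 / 5 * r ^ (5 / 4 : ℝ) := by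
      rw [show (-(3 / 8 : ℝ) + 1) = 5 / 8 by norm_num, show r ^ 2 = r ^ (2 : ℝ) by norm_cast,
        ← Real.rpow_mul hr.le, show (2 : ℝ) * (5 / 8) = 5 / 4 by norm_num]
      ring
    have e2 : z.1 - (z.1 - r ^ 2) = r ^ 2 := by ring
    rw [setLIntegral_congr_fun measurableSet_Ioo hsplit, lintegral_const_mul' _ _ ENNReal.ofReal_ne_top,
      lintegral_add_left (hmT.const_mul _), lintegral_const_mul _ hmT,
      lintegral_Ioo_rpow_sub_eq z.1 hr (by norm_num), setLIntegral_const, Real.volume_Ioo, e1, e2]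
  -- ## assemble and normalise by `r²`
  have htot : ∫⁻ w in parabolicCylinder r z, ‖p w.1 w.2‖ₑ ^ (3 / 2 : ℝ) ≤
      ENNReal.ofReal (r ^ 2) * ENNReal.ofReal (8 / 5 * A * W + r ^ (3 / 4 : ℝ) * B) := by
    refine hT.trans ?_
    rw [htime, ← ENNReal.ofReal_mul hA0, ← ENNReal.ofReal_mul (Real.rpow_nonneg C₂.coe_nonneg _),
      ← ENNReal.ofReal_add (by positivity) (by positivity), ← ENNReal.ofReal_mul (by positivity),
      ← ENNReal.ofReal_mul (by positivity)]
    refine ENNReal.ofReal_le_ofReal (le_of_eq ?_)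
    have h1 : r ^ (3 / 4 : ℝ) * r ^ (5 / 4 : ℝ) = r ^ 2 := by
      rw [← Real.rpow_add hr, show (3 / 4 : ℝ) + 5 / 4 = 2 by norm_num]; norm_cast
    rw [hB_def]
    calc W * r ^ (3 / 4 : ℝ) * (A * (8 / 5 * r ^ (5 / 4 : ℝ)) + (C₂ : ℝ) ^ (3 / 4 : ℝ) * r ^ 2)
        = 8 / 5 * A * W * (r ^ (3 / 4 : ℝ) * r ^ (5 / 4 : ℝ)) + r ^ 2 * (r ^ (3 / 4 : ℝ) * (W * (C₂ : ℝ) ^ (3 / 4 : ℝ))) := by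
          ring
      _ = r ^ 2 * (8 / 5 * A * W + r ^ (3 / 4 : ℝ) * (W * (C₂ : ℝ) ^ (3 / 4 : ℝ))) := by rw [h1]; ring
  -- the shell term is washed out: `r^{3/4} B ≤ 1`
  have hwash : r ^ (3 / 4 : ℝ) * B ≤ 1 := by
    have hrB : r ≤ ((1 + B) ^ 2)⁻¹ := hrμ.trans (min_le_right _ _)
    have hsq : Real.sqrt r ≤ (1 + B)⁻¹ := by
      have h := Real.sqrt_le_sqrt hrB
      rwa [Real.sqrt_inv, Real.sqrt_sq (by linarith)] at h
    have h34 : r ^ (3 / 4 : ℝ) ≤ Real.sqrt r := by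
      rw [Real.sqrt_eq_rpow]
      exact Real.rpow_le_rpow_of_exponent_ge hr hr1 (by norm_num)
    calc r ^ (3 / 4 : ℝ) * B ≤ (1 + B)⁻¹ * B := mul_le_mul_of_nonneg_right (h34.trans hsq) hB0
      _ ≤ 1 := by rw [inv_mul_le_iff₀ (by linarith)]; linarith
  have hK : (((8 / 5 * A * W + 1).toNNReal : ℝ≥0) : ℝ≥0∞) = ENNReal.ofReal (8 / 5 * A * W + 1) := rfl
  have hr2 : ENNReal.ofReal (r ^ 2) ≠ 0 := by positivity
  unfold cknD
  rw [← ENNReal.ofReal_pow hr.le, hK]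
  calc (ENNReal.ofReal (r ^ 2))⁻¹ * ∫⁻ w in parabolicCylinder r z, ‖p w.1 w.2‖ₑ ^ (3 / 2 : ℝ)
      ≤ (ENNReal.ofReal (r ^ 2))⁻¹ * (ENNReal.ofReal (r ^ 2) * ENNReal.ofReal (8 / 5 * A * W + r ^ (3 / 4 : ℝ) * B)) := by
        gcongr
    _ = ENNReal.ofReal (8 / 5 * A * W + r ^ (3 / 4 : ℝ) * B) := by
        rw [← mul_assoc, ENNReal.inv_mul_cancel hr2 ENNReal.ofReal_ne_top, one_mul]
    _ ≤ ENNReal.ofReal (8 / 5 * A * W + 1) := ENNReal.ofReal_le_ofReal (by linarith)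

end Summit.NavierStokesRegularity.NavierStokesRegularity.Theorems.QuietScarPocketDoor

end
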